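/-
COR-CM (cell pub-hodgecm2) — Δ2 BRIDGE, THE `μ ↦ μᶜ` IDENTIFICATION LEMMA, SPACE FACE (e), END-FACING COROLLARY OF THE CONJUGATE RECORD
(audit seat pub-hodgeaudit-ident-1 gen 2, checker ident-2; PLANNER-A RSCONJ TABLE row I «the identification theorem», ident-2 RSCONJ
CHECKER NOTE 1 (d) item A4 ∕ A6).  NEW FILE, THEOREMS ONLY: no `def`, no instance, no named-fact hypothesis, no `sorry`; nothing landed is
edited.  HC_CM is NOT proved; «Δ2 BRIDGE CLOSED» is NOT claimed; the conjugate record itself (`RecordSystem.exists_conj`, RSCONJ rows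
R0–R5) is NOT constructed here — it enters as an EXPLICIT HYPOTHESIS `hM` ∕ `hA` of the exact shape of that construction's conclusion.
-/
import Summits.HodgeConjecture.CorCM.B01.Transposition.HComp.Sec42DataOf
import HarnessLib

set_option autoImplicit false

/-!
# The identification lemma, space face (e): `ℭ.X = M^{(c)}` IS the model functor of ANY record of the conjugate space whose models
# are `M^{(c)}` re-indexed — the END-facing corollary of RSCONJ's `RecordSystem.exists_conj`

[Liu2021] = Y. Liu, *Fourier–Jacobi cycles and arithmetic relative trace formula*, Camb. J. Math. **9** (2021) = arXiv:2102.11518.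

CONTEXT.  ✔ `D2Bridge/MuConjIdentification.lean` (p375496) §4 proves the kernel half of (e): the variety of the §4.2 datum of record is
`ℭ.X_K = M_K ⊗_{F,c} F` (`X_sec42DataOfFourLe_eq_baseChange_complexConj_record`), with the RIDER «`M^{(c)} ≅ X(𝕍^{(c)})` = desk ∕ print»
(d2bridge-ref G45 §0, G49 IDENT-SCOPE PARTIAL).  The staffed item removing the rider on the SPACE face (coordinator 2026-08-24T04:22Z;
PLANNER-A RSCONJ TABLE; lead pen mukey-p6, skeleton mukey-p2 `RecordSystemConjSkeleton.lean` 0b87d68512da3d2b) is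
`UnitaryCanonicalModel.RecordSystem.exists_conj (R : RecordSystem L H τ T hT K₀) : ∃ R' : RecordSystem L c(H) τ T̄ hT̄ c(K₀),
R'.M = smallLevelConjBack ⋙ R.M ⋙ baseChangeHom c` — «the twisted system `K' ↦ M_{c⁻¹K'} ⊗_{L,c} L` IS a Deligne record (all seven
clauses (F1)–(F3) of `RecordSystem`, [Deligne1979] 2.1.2–2.2.5 as typed in `UnitaryShimuraCanonicalModel.lean` :308–:370) of the
CONJUGATE hermitian space `c(H)` along the SAME `τ`, indexed by the levels of `U(cH)(𝔸_{L⁺,f})`».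

WHAT THIS FILE PROVES (kernel, unconditional; every proof is `Functor.congr_obj` ∕ `rfl` ∕ `dif_pos` bookkeeping) — the statement the
re-signers cite at the END's datum (ident-2 CHECKER NOTE 1 (d) A4: «∃ R′ record of c(H), ∀ K, ℭ.X K = R′.M.obj (conjLevel K)»), GENERIC in
the re-indexing so that it does not depend on the names RSCONJ row R0 will give (`Ψ` := its `smallLevelConjBack`, `χ` := its level
transport `K ↦ c(K)`, `hχ` := `c⁻¹(c(K)) = K`, dischargeable by `OpenCompactSubgroup_transport_symm_transport` below):
§1 GENERIC — for records `R` of `H` and `R'` of any `H'` (same `L`, same `τ`) with `R'.M = Ψ ⋙ R.M ⋙ baseChangeHom (cmConjRingHom L)`: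
   `R'.M.obj K' = M_{Ψ K'} ⊗_c L` and, along a section `χ` of `Ψ` on objects, `M_K ⊗_c L = R'.M.obj (χ K)`; the index identity
   `transport e.symm (transport e K) = K` for any isomorphism `e` of topological groups (the `hχ` of the conjugate re-indexing).
§2 AT THE §4.2 DATUM OF RECORD, `4 ≤ [F:ℚ]` (`ℭ := sec42DataOfFourLe h V Φ h4 iso`): functor level `ℭ.cpt.X = (recordOf h V h4).M ⋙ baseChangeHom c`
   (unconditional; strengthens p375496 :373 from objects to the functor); given `hM` for `R := recordOf h V h4`: `Ψ ⋙ ℭ.cpt.X = R'.M` and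
   `ℭ.X K = R'.M.obj (χ K)`; ∃-form from `hA : ∃ R', R'.M = Ψ ⋙ (recordOf h V h4).M ⋙ baseChangeHom c` (= RSCONJ's target AT the record of
   record): `∃ R' : RecordSystem F H' ι₁ T' hT' K₀', Ψ ⋙ ℭ.cpt.X = R'.M ∧ ∀ K, ℭ.X K = R'.M.obj (χ K)`.
§3 AT THE LITERAL END DATUM `ℭ := sec42DataOf h iso F ι₁ V Φ`, `6 ≤ [F:ℚ]`, at the level `ℭ.levelOf K` the END's `HomK K` reads: the same two.
So once RSCONJ lands `exists_conj`, the SPACE face of (e) reads, in the kernel and BY CONSTRUCTION: «the END's `X_K` (whose Albanese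
`A_K` and `Hom_F(A_K, A_ν)_ℚ` the row `hLiuC` consumes, ✔ `MuConjIdent.HomK_eq`) is the canonical-model system of the conjugate space
`V^{(c)} = (F³, c∘h)` along `ι₁` at the level `c(K)`» — `hA` discharged by `RecordSystem.exists_conj (recordOf h V h4)`, `hχ` by §1.
NOT HERE: the construction of `R'` (RSCONJ R0–R5); canonical-model UNIQUENESS ([Milne2005] Thm. 13.7 (a); PLANNER-A row U) — not needed
for the by-construction form (ident-2 (d) A5); the ω-LABEL face of the orientation bit (cited convention `D_BMM`; ident-2 (f)).  HC_CM is NOT proved.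
References: [Liu2021] §4.2 (FJcycle.tex ll. 2053–2074), Thm. 4.18 (1) (l. 2239), App. C §C.1 (ll. 4575–4599), Prop. C.5 (ll. 4627–4633),
l. 4656; [Deligne1979] P. Deligne, *Variétés de Shimura*, 2.1.2–2.1.4, 2.2.5, Cor. 2.7.21; [Milne2005] J. Milne, *Introduction to Shimura
varieties*, Def. 12.10, Thm. 13.7.
-/

noncomputable section

namespace Summit.HodgeConjecture.CorCM.D2Bridge.MuConjIdent

open CategoryTheory NumberField
open Literature.AlgebraicGeometry.Motives (baseChangeHom)
open Literature.AlgebraicGeometry.ShimuraVarieties.UnitaryCanonicalModel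
open Literature.NumberTheory.Automorphic
open Literature.NumberTheory.Automorphic.Liu2021.AppendixC
open Literature.Geometry.ComplexHyperbolic
open Summit.HodgeConjecture.CorCM.Model Summit.HodgeConjecture.CorCM.HComp

/-! ## §1 GENERIC: a record whose model functor is another record's, re-indexed and twisted by `c` -/

section Generic

/-- **The models of the conjugate record, levelwise**: if `R'` (a record of `H'` along `τ`) has model functor `Ψ ⋙ R.M ⋙ (· ⊗_{L,c} L)`
for a record `R` of `H` and a re-indexing `Ψ` of levels ([Deligne1979] 2.1.2–2.1.4: the models form an inverse system on the open compact
levels), then `R'.M_{K'} = M_{Ψ K'} ⊗_{L,c} L` as `L`-schemes (`Functor.congr_obj`).  Bookkeeping, ours.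
[cite: Deligne1979ShimuraVarieties, 2.1.2–2.1.4 and 2.2.5] [cite: Milne2005ShimuraVarieties, Def. 12.10 p. 115] -/
theorem conjRecord_M_obj_eq (L : Type) [Field L] [NumberField L] [IsCMField L] {H H' : Matrix (Fin 3) (Fin 3) L} {τ : L →+* ℂ}
    {T T' : GL (Fin 3) ℂ} {hT : formCongr (starRingEnd ℂ) T (H.map τ) = BallModel.J}
    {hT' : formCongr (starRingEnd ℂ) T' (H'.map τ) = BallModel.J}
    {K₀ : C5.OpenCompactSubgroup ↥(UnitaryGroup.finAdelic (↥(maximalRealSubfield L)) L (IsCMField.complexConj L) 3 H)}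
    {K₀' : C5.OpenCompactSubgroup ↥(UnitaryGroup.finAdelic (↥(maximalRealSubfield L)) L (IsCMField.complexConj L) 3 H')}
    (R : RecordSystem L H τ T hT K₀) (R' : RecordSystem L H' τ T' hT' K₀') (Ψ : C5.SmallLevel K₀' ⥤ C5.SmallLevel K₀)
    (hM : R'.M = Ψ ⋙ R.M ⋙ baseChangeHom (cmConjRingHom L)) (K' : C5.SmallLevel K₀') :
    R'.M.obj K' = (baseChangeHom (cmConjRingHom L)).obj (R.M.obj (Ψ.obj K')) :=
  Functor.congr_obj hM K'

/-- **… and along a section `χ` of the re-indexing** (`Ψ (χ K) = K`, e.g. `c⁻¹(c(K)) = K`): `M_K ⊗_{L,c} L = R'.M_{χ K}`.  Bookkeeping, ours.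
[cite: Deligne1979ShimuraVarieties, 2.1.2–2.1.4 and 2.2.5] [cite: Milne2005ShimuraVarieties, Def. 12.10 p. 115] -/
theorem baseChange_record_M_obj_eq_conjRecord_M_obj (L : Type) [Field L] [NumberField L] [IsCMField L]
    {H H' : Matrix (Fin 3) (Fin 3) L} {τ : L →+* ℂ} {T T' : GL (Fin 3) ℂ}
    {hT : formCongr (starRingEnd ℂ) T (H.map τ) = BallModel.J}
    {hT' : formCongr (starRingEnd ℂ) T' (H'.map τ) = BallModel.J}
    {K₀ : C5.OpenCompactSubgroup ↥(UnitaryGroup.finAdelic (↥(maximalRealSubfield L)) L (IsCMField.complexConj L) 3 H)}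
    {K₀' : C5.OpenCompactSubgroup ↥(UnitaryGroup.finAdelic (↥(maximalRealSubfield L)) L (IsCMField.complexConj L) 3 H')}
    (R : RecordSystem L H τ T hT K₀) (R' : RecordSystem L H' τ T' hT' K₀') (Ψ : C5.SmallLevel K₀' ⥤ C5.SmallLevel K₀)
    (hM : R'.M = Ψ ⋙ R.M ⋙ baseChangeHom (cmConjRingHom L)) (χ : C5.SmallLevel K₀ → C5.SmallLevel K₀')
    (hχ : ∀ K, Ψ.obj (χ K) = K) (K : C5.SmallLevel K₀) :
    (baseChangeHom (cmConjRingHom L)).obj (R.M.obj K) = R'.M.obj (χ K) := by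
  rw [conjRecord_M_obj_eq L R R' Ψ hM (χ K), hχ K]

/-- **The index identity of the conjugate re-indexing** (the `hχ` above): transporting a level along an isomorphism `e` of topological
groups and back gives the level, `e⁻¹(e(K)) = K` («regard `K` as a subgroup of `G(τ)(𝔸^∞)` through the fixed isomorphism», [Liu2021]
Prop. C.5 l. 4632, applied to `e` and `e⁻¹`).  Bookkeeping, ours. [cite: Liu2021, Prop. C.5 (FJcycle.tex l. 4632)] -/
theorem OpenCompactSubgroup_transport_symm_transport {G G' : Type} [Group G] [TopologicalSpace G] [Group G'] [TopologicalSpace G']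
    (e : G ≃ₜ* G') (K : C5.OpenCompactSubgroup G) :
    C5.OpenCompactSubgroup.transport e.symm (C5.OpenCompactSubgroup.transport e K) = K := by
  apply Subtype.ext
  apply SetLike.coe_injective
  rw [C5.OpenCompactSubgroup.coe_transport, C5.OpenCompactSubgroup.coe_transport, Set.image_image]
  simp

/-- … and `e(e⁻¹(K')) = K'`. [cite: Liu2021, Prop. C.5 (FJcycle.tex l. 4632)] -/
theorem OpenCompactSubgroup_transport_transport_symm {G G' : Type} [Group G] [TopologicalSpace G] [Group G'] [TopologicalSpace G']
    (e : G ≃ₜ* G') (K' : C5.OpenCompactSubgroup G') :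
    C5.OpenCompactSubgroup.transport e (C5.OpenCompactSubgroup.transport e.symm K') = K' := by
  apply Subtype.ext
  apply SetLike.coe_injective
  rw [C5.OpenCompactSubgroup.coe_transport, C5.OpenCompactSubgroup.coe_transport, Set.image_image]
  simp

/-- A transported small level is small for the transported threshold: `K ≤ K₀ ⇒ e(K) ≤ e(K₀)` (so `K ↦ e(K)` maps `C5.SmallLevel K₀` to
`C5.SmallLevel (e K₀)`; the object part of the conjugate re-indexing `χ`). [cite: Liu2021, Prop. C.5 (FJcycle.tex ll. 4627–4632)] -/
theorem OpenCompactSubgroup_transport_le_transport {G G' : Type} [Group G] [TopologicalSpace G] [Group G'] [TopologicalSpace G']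
    (e : G ≃ₜ* G') (K₀ : C5.OpenCompactSubgroup G) (K : C5.SmallLevel K₀) :
    C5.OpenCompactSubgroup.transport e K.1 ≤ C5.OpenCompactSubgroup.transport e K₀ :=
  C5.OpenCompactSubgroup.transport_mono e K.2

end Generic

/-! ## §2 AT THE §4.2 DATUM OF RECORD (`4 ≤ [F:ℚ]`): `ℭ.X` is the conjugate record's model functor, re-indexed -/

section Space

/-- **`ℭ.cpt.X = M ⋙ (· ⊗_{F,c} F)` at the functor level** (`4 ≤ [F:ℚ]`): the compactified system `X = S̃h(𝕍) = Sh(𝕍)` (Compact Case,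
[Liu2021] l. 4656) of the §4.2 datum of record IS the `c`-twist `conjSystem` of the CHOSEN canonical-model record's `M` (✔ `sec42DataOfFourLe_X`,
✔ `conjSystem`, ✔ `recordFunctorOf_eq`) — as FUNCTORS (transition morphisms included), not only on objects (p375496 :373).  HC_CM is NOT proved.
[cite: Liu2021, §4.2 (FJcycle.tex l. 2062), Prop. C.5 (ll. 4627–4633), l. 4656] [cite: Deligne1979ShimuraVarieties, 2.2.5 and Cor. 2.7.21] -/
theorem cptX_sec42DataOfFourLe_eq_record_M_comp_baseChange (h : exists_recordSystem) {F : CMField} {ι₁ : F →+* ℂ}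
    (V : HermSpace3 F ι₁) (Φ : Literature.AlgebraicGeometry.Motives.CMType F) (h4 : 4 ≤ Module.finrank ℚ F) (iso : ℕ → Prop) :
    (sec42DataOfFourLe h V Φ h4 iso).cpt.X = (recordOf h V h4).M ⋙ baseChangeHom (cmConjRingHom F) := by
  show recordFunctorOf h V ⋙ baseChangeHom (cmConjRingHom F) = _
  rw [recordFunctorOf_eq h V h4]

/-- **`Ψ ⋙ ℭ.cpt.X = R'.M`**: for ANY record `R'` (of any Gram matrix `H'` over `F`, along the same `ι₁`) whose model functor is the chosen
record's `M` re-indexed by `Ψ` and twisted by `c` — the shape of RSCONJ's `RecordSystem.exists_conj` at `R := recordOf h V h4`, `H' = c(V.Hm)`,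
`Ψ = (K' ↦ c⁻¹K')` — the §4.2 datum's system `X`, re-indexed by `Ψ`, IS `R'`'s model functor.  HC_CM is NOT proved; `R'` is a BINDER.
[cite: Liu2021, §4.2 (FJcycle.tex l. 2062), Prop. C.5 (ll. 4627–4633)] [cite: Deligne1979ShimuraVarieties, 2.1.2–2.1.4 and 2.2.5] -/
theorem reindex_comp_cptX_sec42DataOfFourLe_eq_conjRecord_M (h : exists_recordSystem) {F : CMField} {ι₁ : F →+* ℂ}
    (V : HermSpace3 F ι₁) (Φ : Literature.AlgebraicGeometry.Motives.CMType F) (h4 : 4 ≤ Module.finrank ℚ F) (iso : ℕ → Prop)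
    {H' : Matrix (Fin 3) (Fin 3) F} {T' : GL (Fin 3) ℂ} {hT' : formCongr (starRingEnd ℂ) T' (H'.map ι₁) = BallModel.J}
    {K₀' : C5.OpenCompactSubgroup ↥(UnitaryGroup.finAdelic (↥(maximalRealSubfield F)) F (IsCMField.complexConj F) 3 H')}
    (R' : RecordSystem F H' ι₁ T' hT' K₀') (Ψ : C5.SmallLevel K₀' ⥤ C5.SmallLevel (K3 V))
    (hM : R'.M = Ψ ⋙ (recordOf h V h4).M ⋙ baseChangeHom (cmConjRingHom F)) :
    Ψ ⋙ (sec42DataOfFourLe h V Φ h4 iso).cpt.X = R'.M := by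
  rw [cptX_sec42DataOfFourLe_eq_record_M_comp_baseChange, hM]

/-- **(e) levelwise: `ℭ.X_K = R'.M_{χ K}`** — along a section `χ` of the re-indexing on objects (`Ψ (χ K) = K`; for RSCONJ: `χ K = c(K)`,
`c⁻¹(c(K)) = K` by `OpenCompactSubgroup_transport_symm_transport`), the variety `X_K` of the §4.2 datum of record (whose Albanese `A_K` and
`Hom_F(A_K, A_ν)_ℚ` the row `hLiuC` reads) IS the model of the record `R'` at the level `χ K`.  HC_CM is NOT proved; `R'` is a BINDER.
[cite: Liu2021, §4.2 (FJcycle.tex ll. 2062–2072), Thm. 4.18 (1) (l. 2239)] [cite: Deligne1979ShimuraVarieties, 2.1.2–2.1.4 and 2.2.5] -/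
theorem X_sec42DataOfFourLe_eq_conjRecord_M_obj (h : exists_recordSystem) {F : CMField} {ι₁ : F →+* ℂ}
    (V : HermSpace3 F ι₁) (Φ : Literature.AlgebraicGeometry.Motives.CMType F) (h4 : 4 ≤ Module.finrank ℚ F) (iso : ℕ → Prop)
    {H' : Matrix (Fin 3) (Fin 3) F} {T' : GL (Fin 3) ℂ} {hT' : formCongr (starRingEnd ℂ) T' (H'.map ι₁) = BallModel.J}
    {K₀' : C5.OpenCompactSubgroup ↥(UnitaryGroup.finAdelic (↥(maximalRealSubfield F)) F (IsCMField.complexConj F) 3 H')}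
    (R' : RecordSystem F H' ι₁ T' hT' K₀') (Ψ : C5.SmallLevel K₀' ⥤ C5.SmallLevel (K3 V))
    (hM : R'.M = Ψ ⋙ (recordOf h V h4).M ⋙ baseChangeHom (cmConjRingHom F))
    (χ : C5.SmallLevel (K3 V) → C5.SmallLevel K₀') (hχ : ∀ K, Ψ.obj (χ K) = K) (K : C5.SmallLevel (K3 V)) :
    (sec42DataOfFourLe h V Φ h4 iso).X K = R'.M.obj (χ K) := by
  show (baseChangeHom (cmConjRingHom F)).obj ((recordFunctorOf h V).obj K) = _
  rw [recordFunctorOf_eq h V h4]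
  exact baseChange_record_M_obj_eq_conjRecord_M_obj F (recordOf h V h4) R' Ψ hM χ hχ K

/-- **(e), END-FACING ∃-FORM at `4 ≤ [F:ℚ]`**: from RSCONJ's target AT THE RECORD OF RECORD — `hA : ∃ R' : RecordSystem F H' ι₁ T' hT' K₀',
R'.M = Ψ ⋙ (recordOf h V h4).M ⋙ (· ⊗_{F,c} F)` (= `RecordSystem.exists_conj (recordOf h V h4)` with `H' := c(V.Hm)`, `T' := T̄`, `K₀' := c(K_f(3))`,
`Ψ := (K' ↦ c⁻¹K')`) — there is a record `R'` of `H'` along `ι₁` (ALL clauses (F1)–(F3): smooth projective models, complex points `Sh_{K'}(ℂ)`,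
transitions, holomorphy on the tautological ball of `H'^{ι₁}`, pieces, Shimura reciprocity at the diagonal CM pairs) such that the §4.2 datum's
system IS its model functor re-indexed (`Ψ ⋙ ℭ.cpt.X = R'.M`) and `ℭ.X_K = R'.M_{χ K}` at every level.  With RSCONJ's `R'` this is «`M^{(c)}`
IS (the model functor of) a canonical-model system of `Sh(U(V^{(c)}), h_{V^{(c)},ῑ₁})` BY CONSTRUCTION» — the SPACE face of the rider of
p375496 §4 in the kernel; canonical-model uniqueness is not used.  HC_CM is NOT proved; nothing displayed by an END is inhabited here.
[cite: Liu2021, §4.2 (FJcycle.tex ll. 2053–2074), Prop. C.5 (ll. 4627–4633), l. 4656] [cite: Deligne1979ShimuraVarieties, 2.1.2–2.1.4, 2.2.5 and Cor. 2.7.21]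
[cite: Milne2005ShimuraVarieties, Def. 12.10 p. 115] -/
theorem exists_conjRecord_X_sec42DataOfFourLe_eq (h : exists_recordSystem) {F : CMField} {ι₁ : F →+* ℂ}
    (V : HermSpace3 F ι₁) (Φ : Literature.AlgebraicGeometry.Motives.CMType F) (h4 : 4 ≤ Module.finrank ℚ F) (iso : ℕ → Prop)
    {H' : Matrix (Fin 3) (Fin 3) F} {T' : GL (Fin 3) ℂ} {hT' : formCongr (starRingEnd ℂ) T' (H'.map ι₁) = BallModel.J}
    {K₀' : C5.OpenCompactSubgroup ↥(UnitaryGroup.finAdelic (↥(maximalRealSubfield F)) F (IsCMField.complexConj F) 3 H')}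
    (Ψ : C5.SmallLevel K₀' ⥤ C5.SmallLevel (K3 V)) (χ : C5.SmallLevel (K3 V) → C5.SmallLevel K₀') (hχ : ∀ K, Ψ.obj (χ K) = K)
    (hA : ∃ R' : RecordSystem F H' ι₁ T' hT' K₀', R'.M = Ψ ⋙ (recordOf h V h4).M ⋙ baseChangeHom (cmConjRingHom F)) :
    ∃ R' : RecordSystem F H' ι₁ T' hT' K₀',
      Ψ ⋙ (sec42DataOfFourLe h V Φ h4 iso).cpt.X = R'.M ∧ ∀ K : C5.SmallLevel (K3 V), (sec42DataOfFourLe h V Φ h4 iso).X K = R'.M.obj (χ K) := by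
  obtain ⟨R', hM⟩ := hA
  exact ⟨R', reindex_comp_cptX_sec42DataOfFourLe_eq_conjRecord_M h V Φ h4 iso R' Ψ hM,
    X_sec42DataOfFourLe_eq_conjRecord_M_obj h V Φ h4 iso R' Ψ hM χ hχ⟩

end Space

/-! ## §3 AT THE LITERAL END DATUM `ℭ := sec42DataOf h iso F ι₁ V Φ` (`6 ≤ [F:ℚ]`), at the level `ℭ.levelOf K` -/

section SpaceOfRecord

/-- **(e) at the literal §4.2 datum of record and the level the END's `HomK K` reads** (`6 ≤ [F:ℚ]`, ✔ `sec42DataOf_eq_of_six_le`; cf.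
p375496 :384): `ℭ.X_{levelOf K} = R'.M_{χ (levelOf K)}` for any record `R'` with `R'.M = Ψ ⋙ (recordOf h V _).M ⋙ (· ⊗_{F,c} F)` and any section
`χ` of `Ψ` on objects.  HC_CM is NOT proved; `R'` is a BINDER. [cite: Liu2021, §4.2 (FJcycle.tex l. 2062), Thm. 4.18 (1) (l. 2239), Prop. C.5 (ll. 4627–4633)]
[cite: Deligne1979ShimuraVarieties, 2.1.2–2.1.4 and 2.2.5] -/
theorem X_sec42DataOf_levelOf_eq_conjRecord_M_obj (h : exists_recordSystem) {F : CMField} {ι₁ : F →+* ℂ}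
    (V : HermSpace3 F ι₁) (Φ : Literature.AlgebraicGeometry.Motives.CMType F)
    (iso : ∀ (F : CMField) (ι₁ : F →+* ℂ) (_ : HermSpace3 F ι₁) (_ : Literature.AlgebraicGeometry.Motives.CMType F), ℕ → Prop)
    (h6 : 6 ≤ Module.finrank ℚ F)
    {H' : Matrix (Fin 3) (Fin 3) F} {T' : GL (Fin 3) ℂ} {hT' : formCongr (starRingEnd ℂ) T' (H'.map ι₁) = BallModel.J}
    {K₀' : C5.OpenCompactSubgroup ↥(UnitaryGroup.finAdelic (↥(maximalRealSubfield F)) F (IsCMField.complexConj F) 3 H')}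
    (R' : RecordSystem F H' ι₁ T' hT' K₀') (Ψ : C5.SmallLevel K₀' ⥤ C5.SmallLevel (K3 V))
    (hM : R'.M = Ψ ⋙ (recordOf h V (le_trans (by norm_num) h6)).M ⋙ baseChangeHom (cmConjRingHom F))
    (χ : C5.SmallLevel (K3 V) → C5.SmallLevel K₀') (hχ : ∀ K, Ψ.obj (χ K) = K) (K : Subgroup (honestP5Of h F ι₁ V Φ).G) :
    (sec42DataOf h iso F ι₁ V Φ).X ((sec42DataOf h iso F ι₁ V Φ).levelOf K) =
      R'.M.obj (χ ((sec42DataOfFourLe h V Φ (le_trans (by norm_num) h6) (iso F ι₁ V Φ)).levelOf K)) := by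
  rw [sec42DataOf_eq_of_six_le h V Φ iso h6]
  exact X_sec42DataOfFourLe_eq_conjRecord_M_obj h V Φ _ (iso F ι₁ V Φ) R' Ψ hM χ hχ _

/-- **(e), END-FACING ∃-FORM at the literal datum of record** (`6 ≤ [F:ℚ]`): from RSCONJ's target at `R := recordOf h V _` there is a
record `R'` of `H'` along `ι₁` with `Ψ ⋙ ℭ₄.cpt.X = R'.M` (`ℭ₄ := sec42DataOfFourLe …`, to which `sec42DataOf …` reduces, ✔ `sec42DataOf_eq_of_six_le`)
and `ℭ.X_{levelOf K} = R'.M_{χ (levelOf K)}` for every subgroup `K` — the SPACE face of (e) for the END's own `ℭ`, by construction once RSCONJ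
supplies `hA`.  HC_CM is NOT proved; nothing displayed by an END is inhabited here.
[cite: Liu2021, §4.2 (FJcycle.tex ll. 2053–2074), Thm. 4.18 (1) (l. 2239), Prop. C.5 (ll. 4627–4633)] [cite: Deligne1979ShimuraVarieties, 2.2.5 and Cor. 2.7.21] -/
theorem exists_conjRecord_X_sec42DataOf_levelOf_eq (h : exists_recordSystem) {F : CMField} {ι₁ : F →+* ℂ}
    (V : HermSpace3 F ι₁) (Φ : Literature.AlgebraicGeometry.Motives.CMType F)
    (iso : ∀ (F : CMField) (ι₁ : F →+* ℂ) (_ : HermSpace3 F ι₁) (_ : Literature.AlgebraicGeometry.Motives.CMType F), ℕ → Prop)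
    (h6 : 6 ≤ Module.finrank ℚ F)
    {H' : Matrix (Fin 3) (Fin 3) F} {T' : GL (Fin 3) ℂ} {hT' : formCongr (starRingEnd ℂ) T' (H'.map ι₁) = BallModel.J}
    {K₀' : C5.OpenCompactSubgroup ↥(UnitaryGroup.finAdelic (↥(maximalRealSubfield F)) F (IsCMField.complexConj F) 3 H')}
    (Ψ : C5.SmallLevel K₀' ⥤ C5.SmallLevel (K3 V)) (χ : C5.SmallLevel (K3 V) → C5.SmallLevel K₀') (hχ : ∀ K, Ψ.obj (χ K) = K)
    (hA : ∃ R' : RecordSystem F H' ι₁ T' hT' K₀',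
      R'.M = Ψ ⋙ (recordOf h V (le_trans (by norm_num) h6)).M ⋙ baseChangeHom (cmConjRingHom F)) :
    ∃ R' : RecordSystem F H' ι₁ T' hT' K₀',
      Ψ ⋙ (sec42DataOfFourLe h V Φ (le_trans (by norm_num) h6) (iso F ι₁ V Φ)).cpt.X = R'.M ∧
        ∀ K : Subgroup (honestP5Of h F ι₁ V Φ).G,
          (sec42DataOf h iso F ι₁ V Φ).X ((sec42DataOf h iso F ι₁ V Φ).levelOf K) =
            R'.M.obj (χ ((sec42DataOfFourLe h V Φ (le_trans (by norm_num) h6) (iso F ι₁ V Φ)).levelOf K)) := by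
  obtain ⟨R', hM⟩ := hA
  exact ⟨R', reindex_comp_cptX_sec42DataOfFourLe_eq_conjRecord_M h V Φ _ (iso F ι₁ V Φ) R' Ψ hM,
    fun K => X_sec42DataOf_levelOf_eq_conjRecord_M_obj h V Φ iso h6 R' Ψ hM χ hχ K⟩

end SpaceOfRecord

end Summit.HodgeConjecture.CorCM.D2Bridge.MuConjIdent

end
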